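import Literature.Geometry.Lorentzian.KerrIngoingCoordConnection
import Literature.Geometry.Lorentzian.KerrPhotonShellTurningPoints
import HarnessLib

/-!
# Null pseudo-convexity of the Kerr radius level sets off the photon shell

(family `gr`; namespace `Literature.Geometry.Lorentzian.Kerr.Ingoing`; built on the ingoing Kerr
chart `u = (t*, r, μ, φ)` of `KerrIngoingCoordMetric.lean` … `KerrIngoingCoordConnection.lean` — the
rational component field `Kerr.Ingoing.bilin M a`, its first derivatives `bilinR`/`bilinM`, the
coordinate Christoffel map `MetricCoord.chrAt` — and on the turning-point dichotomy of
`KerrPhotonShellTurningPoints.lean`.)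

The geometric reading of the null radial Carter potential `R(r) = (E(r² + a²) − aL)² − Δ(Q + (L − aE)²)`
(`Kerr.nullRadialPotential`), made kernel-checked. For a vector `w` at a chart point `u` let
`E = −g(∂_{t*}, w)`, `L = g(∂_φ, w)` (`Kerr.Ingoing.energy`, `Kerr.Ingoing.angMom`; `∂_{t*}`, `∂_φ`
are Killing) and `Q = p_θ² + cos²θ (L²/sin²θ − a²E²)` with `p_θ² = Σ² (w^μ)²/(1 − μ²)`
(`Kerr.Ingoing.carterQ`, Carter's constant of a NULL geodesic with velocity `w`). Then, as
POLYNOMIAL IDENTITIES in the components (no geodesic, no Killing tensor is invoked):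

* `Σ² (wʳ)² − R(r; E, L, Q) = Σ Δ · g(w, w)` (`sq_sigma_mul_sq_sub_nullRadialPotential`) — on the
  null cone this is Carter's separated radial equation `Σ² ṙ² = R(r)` (Carter 1968, §4);
* for `wʳ = 0`: `2 Σ² · hessR(u, w) − R′(r; E, L, Q) = 2(2r³ − 3Mr² + a²r + a²μ²(r − M)) · g(w, w)`
  (`two_mul_sq_sigma_mul_hessR_sub_deriv`), where `hessR(u, w) = −Γ_u(w, w)ʳ`
  (`Kerr.Ingoing.hessR`) is the radial acceleration `r̈` of the coordinate geodesic with velocity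
  `w` (`ü = −Γ_u(u̇, u̇)`), i.e. the covariant Hessian `Hess_g r (w, w)` (`r` is a coordinate);
* the constants of a vector at an off-axis point are Θ-admissible with witness the point's own
  `μ = cos θ` (`nullThetaAdmissible_constants`: `Θ(μ) = p_θ² ≥ 0`), and a non-zero NULL vector
  off the axis and off the horizons has `(E, L, Q) ≠ 0` (`constants_ne_zero`).

Consequently (`hessR_neg_of_lt_photonOrbitRadius_neg`, `hessR_pos_of_photonOrbitRadius_lt`):
**in exact sub-extremal Kerr, at every off-axis point with `r₊ < r < r_ph⁺ = photonOrbitRadius M (−|a|)`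
every non-zero null vector tangent to the cylinder `{r = const}` has `Hess_g r (w, w) < 0`
(the cylinder is strongly null pseudo-convex towards `{r < c}`: tangential null geodesics have an
apocentre), and at every off-axis point with `r > r_ph⁻ = photonOrbitRadius M |a|` it has
`Hess_g r (w, w) > 0` (pericentre; pseudo-convex towards `{r > c}`)** — the hypersurface condition
under which Ionescu–Klainerman's extension theorem for Killing fields crosses `{r = c}`
(Ionescu–Klainerman, JAMS 26 (2013), Def. 1.1 / Thm. 1.2), and the reason no such sweep crosses the
photon shell `[r_ph⁺, r_ph⁻]` (trapped null geodesics, `Kerr.exists_trappedNullGeodesic`).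

Deliberately NOT here: axis points `μ = ±1` (a coordinate singularity of the chart; the
Kerr–Schild Cartesian statement follows by density and is left to a sequel), the quantitative
margin on compact bands, `C²`-stability under perturbation of the components, and the link
`IsGeodesicOn ↔ ü = −Γ(u̇, u̇)` (`OpensChartGeodesicODE.lean`), which consumers apply to `hessR`.

## References

* B. Carter, *Hamilton–Jacobi and Schrödinger separable solutions of Einstein's equations*,
  Comm. Math. Phys. 10 (1968) 280–310, §4 (the separated null geodesic equations).
* A. D. Ionescu, S. Klainerman, *On the local extension of Killing vector-fields in Ricci flat
  manifolds*, J. Amer. Math. Soc. 26 (2013) 563–593, Def. 1.1, Thm. 1.2.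
* B. O'Neill, *Semi-Riemannian geometry* (1983), Ch. 3, Prop. 3.13 (coordinate Christoffel symbols).
-/

noncomputable section

set_option maxSynthPendingDepth 3

open Set Function Module
open Literature.Geometry.Lorentzian.MetricCoord

namespace Literature.Geometry.Lorentzian

namespace Kerr

namespace Ingoing

variable (M a : ℝ)

/-! ### Constants of motion of a vector in the ingoing chart -/

/-- The **Killing energy** of a vector `w` at the chart point `u`: `E = −g_u(∂_{t*}, w)`
(`∂_{t*}` is the stationary Killing field of Kerr in ingoing coordinates). Carter 1968, §4.
[cite: Carter1968, §4] -/
def energy (u w : E4) : ℝ := -(bilin M a u (E4.basisVector 0) w)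

/-- The **axial angular momentum** of a vector `w` at `u`: `L = g_u(∂_φ, w)` (`∂_φ` the axial
Killing field). Carter 1968, §4. [cite: Carter1968, §4] -/
def angMom (u w : E4) : ℝ := bilin M a u (E4.basisVector 3) w

/-- The **Carter constant of a null vector** `w` at `u = (t*, r, μ, φ)`:
`Q = p_θ² + cos²θ (L²/sin²θ − a²E²)` with `p_θ² = p_μ² (1 − μ²) = Σ² (w^μ)²/(1 − μ²)`
(`p_μ = g(∂_μ, w) = Σ w^μ/(1 − μ²)`), written as `Σ²(w²)²/(1 − μ²) − μ²(a²E² − L²/(1 − μ²))` so that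
Θ-admissibility at `z = μ` is read off. For a null geodesic this is Carter's `𝒬` (Carter 1968, §4,
with vanishing rest mass); as a function of an arbitrary vector it is just this quadratic form.
[cite: Carter1968, §4] -/
def carterQ (u w : E4) : ℝ :=
  sigma a u ^ 2 * w 2 ^ 2 / sinSq u - u 2 ^ 2 * (a ^ 2 * energy M a u w ^ 2 - angMom M a u w ^ 2 / sinSq u)

/-- The **gradient of the radius**, `∇r = g⁻¹ dr`: the vector with `g_u(v, ∇r) = vʳ` for all `v`
(`bilin_gradR`), i.e. the row `r` of the inverse Kerr components `ginvMat`: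
`(2Mr/Σ, Δ/Σ, 0, a/Σ)`. [folklore] -/
def gradR (u : E4) : E4 :=
  !₂[h00 M a u, (u 1 ^ 2 + a ^ 2) / sigma a u - h00 M a u, 0, a / sigma a u]

/-- The **radial geodesic acceleration** of a vector `w` at `u`: `hessR(u, w) = −Γ_u(w, w)ʳ`, the
`r`-component of minus the coordinate Christoffel map (`MetricCoord.chrAt`) of the Kerr components
on `(w, w)`. Along a coordinate geodesic `ü = −Γ_u(u̇, u̇)` this is `r̈`; since `r` is a coordinate
it is also the covariant Hessian `Hess_g r (w, w) = D²r(w,w) − dr(Γ(w,w))` (O'Neill 1983, Ch. 3,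
Prop. 3.13 and Def. 3.48). [folklore] -/
def hessR (u w : E4) : ℝ := -(chrAt (bilin M a) u w w 1)

variable {M a} {u : E4}

/-- `E` evaluated: `E = w⁰ − h₀₀ (w⁰ + wʳ) − h₀₃ w^φ`. [folklore] -/
theorem energy_eq (u w : E4) :
    energy M a u w = w 0 - h00 M a u * (w 0 + w 1) - h03 M a u * w 3 := by
  unfold energy
  rw [bilin_apply]
  simp only [bv_apply, Fin.isValue, Fin.reduceEq, if_true, if_false]
  ring

/-- `L` evaluated: `L = c₁₃ wʳ + c₃₃ w^φ + h₀₃ (w⁰ + wʳ)`. [folklore] -/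
theorem angMom_eq (u w : E4) :
    angMom M a u w = c13 a u * w 1 + c33 M a u * w 3 + h03 M a u * (w 0 + w 1) := by
  unfold angMom
  rw [bilin_apply]
  simp only [bv_apply, Fin.isValue, Fin.reduceEq, if_true, if_false]
  ring

/-- Components of `∇r`. [folklore] -/
theorem gradR_apply_zero (u : E4) : gradR M a u 0 = h00 M a u := by
  simp [gradR]

/-- Components of `∇r`. [folklore] -/
theorem gradR_apply_one (u : E4) : gradR M a u 1 = (u 1 ^ 2 + a ^ 2) / sigma a u - h00 M a u := by
  simp [gradR]

/-- Components of `∇r`. [folklore] -/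
theorem gradR_apply_two (u : E4) : gradR M a u 2 = 0 := by
  simp [gradR]

/-- Components of `∇r`. [folklore] -/
theorem gradR_apply_three (u : E4) : gradR M a u 3 = a / sigma a u := by
  simp [gradR]

/-- **`∇r` represents `dr`**: `g_u(v, ∇r) = vʳ` for every `v` (on `Σ ≠ 0`). [folklore] -/
theorem bilin_gradR (hS : sigma a u ≠ 0) (v : E4) : bilin M a u v (gradR M a u) = v 1 := by
  rw [bilin_apply]
  simp only [gradR_apply_zero, gradR_apply_one, gradR_apply_two, gradR_apply_three]
  simp only [h00, h03, c13, c22, c33, scalarH]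
  field_simp
  simp only [sigma, sinSq]
  ring

/-- `∂_μ g` is symmetric. [folklore] -/
theorem bilinM_symm (u v w : E4) : bilinM M a u v w = bilinM M a u w v := by
  rw [bilinM_apply, bilinM_apply]; ring

/-- **The radial acceleration in closed form.** On the regular set, for a vector tangent to the
cylinder (`wʳ = 0`): `2 hessR(u, w) = (Δ/Σ) (∂_r g)(w, w) − 2 w^μ (∂_μ g)(w, ∇r)` — from
`2 g(Γ(w,w), ∇r) = K(w, w, ∇r) = 2 ∂_w g(w, ∇r) − ∂_{∇r} g(w, w)` and `∂_V g = Vʳ ∂_r g + V^μ ∂_μ g`.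
[cite: ONeill1983, Ch. 3, Prop. 3.13] -/
theorem two_mul_hessR_eq (hu : u ∈ regularSet a) {w : E4} (hw : w 1 = 0) :
    2 * hessR M a u w =
      (u 1 ^ 2 - 2 * M * u 1 + a ^ 2) / sigma a u * bilinR M a u w w -
        2 * w 2 * bilinM M a u w (gradR M a u) := by
  have hS := hu.1
  have h1 : chrAt (bilin M a) u w w 1 = bilin M a u (chrAt (bilin M a) u w w) (gradR M a u) :=
    (bilin_gradR hS _).symm
  have h2 : 2 * bilin M a u (chrAt (bilin M a) u w w) (gradR M a u) =
      koszulCLM (bilin M a) u w w (gradR M a u) :=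
    two_mul_apply_chrAt (isInvertible_bilin M a hu) w w (gradR M a u)
  have h3 : koszulCLM (bilin M a) u w w (gradR M a u) =
      2 * w 2 * bilinM M a u w (gradR M a u) -
        (u 1 ^ 2 - 2 * M * u 1 + a ^ 2) / sigma a u * bilinR M a u w w := by
    rw [koszulCLM_eq_koszulForm, koszulForm_bilin M a hu, hw, gradR_apply_one, gradR_apply_two,
      bilinM_symm u (gradR M a u) w]
    simp only [h00, scalarH]
    field_simp
    ring
  unfold hessR
  rw [h1]
  linarith [h2, h3]

/-! ### The two separation identities -/

/-- **Carter's radial equation as a polynomial identity.** For every vector `w` at a point of the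
regular set `{Σ ≠ 0, μ² ≠ 1}`:
`Σ² (wʳ)² − R(r; E, L, Q) = Σ Δ · g(w, w)`, with `E, L, Q` the constants of `w` and `R` the null
radial Carter potential (`Kerr.nullRadialPotential`). On the null cone: `Σ² ṙ² = R(r)`
(Carter 1968, §4). [cite: Carter1968, §4] -/
theorem sq_sigma_mul_sq_sub_nullRadialPotential (hu : u ∈ regularSet a) (w : E4) :
    sigma a u ^ 2 * w 1 ^ 2 -
        nullRadialPotential M a (energy M a u w) (angMom M a u w) (carterQ M a u w) (u 1) =
      sigma a u * (u 1 ^ 2 - 2 * M * u 1 + a ^ 2) * bilin M a u w w := by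
  have hS := hu.1
  have hP := hu.2
  unfold nullRadialPotential carterQ
  rw [energy_eq, angMom_eq, bilin_apply]
  simp only [h00, h03, c13, c22, c33, scalarH]
  field_simp
  simp only [sigma, sinSq] at hS hP ⊢
  ring

/-- **The radial acceleration at a tangency as a polynomial identity.** For every vector `w`
TANGENT to the cylinder (`wʳ = 0`) at a point of the regular set:
`2 Σ² · hessR(u, w) − R′(r; E, L, Q) = 2(2r³ − 3Mr² + a²r + a²μ²(r − M)) · g(w, w)`.
On the null cone: `r̈ = R′(r)/(2Σ²)` at a turning point — differentiate `Σ² ṙ² = R(r)` along the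
geodesic and cancel `ṙ` (here obtained pointwise, without geodesics). [cite: Carter1968, §4] -/
theorem two_mul_sq_sigma_mul_hessR_sub_deriv (hu : u ∈ regularSet a) {w : E4} (hw : w 1 = 0) :
    2 * sigma a u ^ 2 * hessR M a u w -
        deriv (nullRadialPotential M a (energy M a u w) (angMom M a u w) (carterQ M a u w)) (u 1) =
      2 * (2 * u 1 ^ 3 - 3 * M * u 1 ^ 2 + a ^ 2 * u 1 + a ^ 2 * u 2 ^ 2 * (u 1 - M)) *
        bilin M a u w w := by
  have hS := hu.1
  have hP := hu.2
  have h2 : 2 * sigma a u ^ 2 * hessR M a u w = sigma a u ^ 2 * (2 * hessR M a u w) := by ring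
  rw [h2, two_mul_hessR_eq hu hw, deriv_nullRadialPotential]
  unfold carterQ
  rw [energy_eq, angMom_eq, bilin_apply, bilinR_apply, bilinM_apply]
  simp only [hw, gradR_apply_zero, gradR_apply_one, gradR_apply_two, gradR_apply_three]
  simp only [h00, h03, c13, c22, c33, c22r, c22m, c33r, c33m, h00r, h00m, h03r, h03m, scalarH,
    scalarHr, scalarHm]
  field_simp
  simp only [sigma, sinSq] at hS hP ⊢
  ring

/-! ### Admissibility and non-triviality of the constants -/

/-- **Θ-admissibility is automatic off the axis**: at a point with `μ² < 1` the constants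
`(E, L, Q)` of ANY vector are Θ-admissible (`Kerr.NullThetaAdmissible`), with witness `z = μ`:
`Q + μ²(a²E² − L²/(1 − μ²)) = Σ² (w^μ)²/(1 − μ²) = p_θ² ≥ 0`. [cite: Carter1968, §4] -/
theorem nullThetaAdmissible_constants (hμ : u 2 ^ 2 < 1) (w : E4) :
    NullThetaAdmissible a (energy M a u w) (angMom M a u w) (carterQ M a u w) := by
  refine ⟨u 2, hμ, ?_⟩
  have hP : 0 < 1 - u 2 ^ 2 := sub_pos.2 hμ
  have h : carterQ M a u w + u 2 ^ 2 * (a ^ 2 * energy M a u w ^ 2 -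
      angMom M a u w ^ 2 / (1 - u 2 ^ 2)) = sigma a u ^ 2 * w 2 ^ 2 / (1 - u 2 ^ 2) := by
    unfold carterQ sinSq
    ring
  rw [h]
  positivity

/-- `(1 − h₀₀) c₃₃ + h₀₃² = (1 − μ²) Δ`: the determinant of the `(t*, φ)` block of the lowered
pairings against `∂_{t*}`, `∂_φ`. [folklore] -/
theorem one_sub_h00_mul_c33_add_sq (hS : sigma a u ≠ 0) :
    (1 - h00 M a u) * c33 M a u + h03 M a u ^ 2 = sinSq u * (u 1 ^ 2 - 2 * M * u 1 + a ^ 2) := by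
  simp only [h00, h03, c33, scalarH]
  field_simp
  simp only [sigma, sinSq]
  ring

/-- **A non-zero null vector has non-trivial constants** off the axis and off the horizons
(`Σ ≠ 0`, `μ² ≠ 1`, `Δ ≠ 0`): if `E = L = Q = 0` then `Σ² (wʳ)² = R ≡ 0` gives `wʳ = 0`,
`Q = p_θ² = 0` gives `w^μ = 0`, and `E = L = 0` is a linear system in `(w⁰, w^φ)` of determinant
`(1 − μ²) Δ`. [folklore] -/
theorem constants_ne_zero (hu : u ∈ regularSet a) (hΔ : u 1 ^ 2 - 2 * M * u 1 + a ^ 2 ≠ 0)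
    {w : E4} (hw : w ≠ 0) (hnull : bilin M a u w w = 0) :
    energy M a u w ≠ 0 ∨ angMom M a u w ≠ 0 ∨ carterQ M a u w ≠ 0 := by
  have hS := hu.1
  have hP := hu.2
  by_contra h
  push Not at h
  obtain ⟨hE, hL, hQ⟩ := h
  apply hw
  -- `wʳ = 0` from the radial identity
  have hI := sq_sigma_mul_sq_sub_nullRadialPotential (M := M) hu w
  rw [hE, hL, hQ, hnull] at hI
  have hR0 : nullRadialPotential M a 0 0 0 (u 1) = 0 := by unfold nullRadialPotential; ring
  rw [hR0] at hI
  have h1 : w 1 = 0 := by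
    have : sigma a u ^ 2 * w 1 ^ 2 = 0 := by linarith
    rcases mul_eq_zero.1 this with h | h
    · exact absurd (pow_eq_zero_iff (n := 2) (by norm_num) |>.1 h) hS
    · exact pow_eq_zero_iff (n := 2) (by norm_num) |>.1 h
  -- `w^μ = 0` from `Q = 0`
  have h2 : w 2 = 0 := by
    have hQ' := hQ
    unfold carterQ at hQ'
    rw [hE, hL] at hQ'
    have : sigma a u ^ 2 * w 2 ^ 2 / sinSq u = 0 := by
      have e : sigma a u ^ 2 * w 2 ^ 2 / sinSq u -
          u 2 ^ 2 * (a ^ 2 * (0 : ℝ) ^ 2 - (0 : ℝ) ^ 2 / sinSq u) =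
            sigma a u ^ 2 * w 2 ^ 2 / sinSq u := by ring
      rw [e] at hQ'
      exact hQ'
    rw [div_eq_zero_iff] at this
    rcases this with h | h
    · rcases mul_eq_zero.1 h with h | h
      · exact absurd (pow_eq_zero_iff (n := 2) (by norm_num) |>.1 h) hS
      · exact pow_eq_zero_iff (n := 2) (by norm_num) |>.1 h
    · exact absurd h hP
  -- the `(t*, φ)` block
  have hE' : (1 - h00 M a u) * w 0 - h03 M a u * w 3 = 0 := by
    rw [energy_eq, h1] at hE
    linarith
  have hL' : c33 M a u * w 3 + h03 M a u * w 0 = 0 := by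
    rw [angMom_eq, h1] at hL
    linarith
  have hdet := one_sub_h00_mul_c33_add_sq (M := M) hS
  have hdet0 : (1 - h00 M a u) * c33 M a u + h03 M a u ^ 2 ≠ 0 := by
    rw [hdet]; exact mul_ne_zero hP hΔ
  have h0 : w 0 = 0 := by
    have : ((1 - h00 M a u) * c33 M a u + h03 M a u ^ 2) * w 0 = 0 := by
      have e : ((1 - h00 M a u) * c33 M a u + h03 M a u ^ 2) * w 0 =
          c33 M a u * ((1 - h00 M a u) * w 0 - h03 M a u * w 3) +
            h03 M a u * (c33 M a u * w 3 + h03 M a u * w 0) := by ring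
      rw [e, hE', hL']; ring
    rcases mul_eq_zero.1 this with h | h
    · exact absurd h hdet0
    · exact h
  have h3 : w 3 = 0 := by
    have : ((1 - h00 M a u) * c33 M a u + h03 M a u ^ 2) * w 3 = 0 := by
      have e : ((1 - h00 M a u) * c33 M a u + h03 M a u ^ 2) * w 3 =
          (1 - h00 M a u) * (c33 M a u * w 3 + h03 M a u * w 0) -
            h03 M a u * ((1 - h00 M a u) * w 0 - h03 M a u * w 3) := by ring
      rw [e, hE', hL']; ring
    rcases mul_eq_zero.1 this with h | h
    · exact absurd h hdet0
    · exact h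
  ext i
  fin_cases i
  · exact h0
  · exact h1
  · exact h2
  · exact h3

/-! ### The sign of the radial acceleration off the photon shell -/

/-- `Δ(r) = r² − 2Mr + a² > 0` beyond the outer horizon `r > r₊ = M + √(M² − a²)` (`|a| ≤ M`).
[folklore] -/
theorem delta_pos_of_rPlus_lt {M a r : ℝ} (ha : |a| ≤ M) (hr : rPlus M a < r) :
    0 < r ^ 2 - 2 * M * r + a ^ 2 := by
  have hMa : 0 ≤ M ^ 2 - a ^ 2 := by nlinarith [abs_nonneg a, sq_abs a]
  have hs : 0 ≤ √(M ^ 2 - a ^ 2) := Real.sqrt_nonneg _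
  have hs2 : √(M ^ 2 - a ^ 2) ^ 2 = M ^ 2 - a ^ 2 := Real.sq_sqrt hMa
  unfold rPlus at hr
  nlinarith

/-- At an off-axis point beyond the outer horizon the chart point is regular and `Δ > 0`.
[folklore] -/
theorem mem_regularSet_of_rPlus_lt {M : ℝ} (hM : 0 < M) (hr : rPlus M a < u 1)
    (hμ : u 2 ^ 2 < 1) : u ∈ regularSet a := by
  have hr0 : 0 < u 1 := by
    have : M ≤ rPlus M a := by
      unfold rPlus; linarith [Real.sqrt_nonneg (M ^ 2 - a ^ 2)]
    linarith
  refine ⟨?_, ?_⟩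
  · unfold sigma; positivity
  · unfold sinSq; linarith

/-- **Inward pseudo-convexity below the inner photon orbit (apocentres).** In sub-extremal Kerr
(`0 < M`, `|a| < M`), at every off-axis chart point with `r₊ < r < r_ph⁺ = photonOrbitRadius M (−|a|)`,
every non-zero NULL vector `w` tangent to the cylinder `{r = const}` (`wʳ = 0`) has
`hessR(u, w) = Hess_g r (w, w) < 0`: the tangential null geodesic has a strict apocentre, i.e. the
cylinder is strongly null pseudo-convex towards `{r < c}` — for every Killing energy, the
ergoregion's `E ≤ 0` included. Proof: `Hess_g r(w,w) = R′(r)/(2Σ²)` with `R(r) = 0`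
(the two identities on the null cone), `(E, L, Q)` Θ-admissible and non-trivial, and
`Kerr.deriv_nullRadialPotential_neg_of_lt_photonOrbitRadius_neg`. The axis `μ = ±1` is outside the
chart. [cite: IonescuKlainerman2012, Def. 1.1] -/
theorem hessR_neg_of_lt_photonOrbitRadius_neg {M : ℝ} (hM : 0 < M) (ha : |a| < M)
    (hr₁ : rPlus M a < u 1) (hr₂ : u 1 < photonOrbitRadius M (-|a|)) (hμ : u 2 ^ 2 < 1)
    {w : E4} (hw : w ≠ 0) (hnull : bilin M a u w w = 0) (htan : w 1 = 0) :
    hessR M a u w < 0 := by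
  have hu : u ∈ regularSet a := mem_regularSet_of_rPlus_lt hM hr₁ hμ
  have hΔ : 0 < u 1 ^ 2 - 2 * M * u 1 + a ^ 2 := delta_pos_of_rPlus_lt ha.le hr₁
  have hS : 0 < sigma a u ^ 2 := by positivity [hu.1]
  set E := energy M a u w
  set L := angMom M a u w
  set Q := carterQ M a u w
  have hroot : nullRadialPotential M a E L Q (u 1) = 0 := by
    have h := sq_sigma_mul_sq_sub_nullRadialPotential (M := M) hu w
    rw [htan, hnull] at h
    simpa using h
  have hadm : NullThetaAdmissible a E L Q := nullThetaAdmissible_constants hμ w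
  have hne : E ≠ 0 ∨ L ≠ 0 ∨ Q ≠ 0 := constants_ne_zero hu hΔ.ne' hw hnull
  have hd : deriv (nullRadialPotential M a E L Q) (u 1) < 0 :=
    deriv_nullRadialPotential_neg_of_lt_photonOrbitRadius_neg hM ha hr₁ hr₂ hadm hne hroot
  have hII := two_mul_sq_sigma_mul_hessR_sub_deriv (M := M) hu htan
  rw [hnull, mul_zero] at hII
  have : 2 * sigma a u ^ 2 * hessR M a u w < 0 := by linarith
  nlinarith

/-- **Outward pseudo-convexity beyond the outer photon orbit (pericentres).** In sub-extremal
Kerr, at every off-axis chart point with `r > r_ph⁻ = photonOrbitRadius M |a|` (`∈ [3M, 4M]`),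
every non-zero null vector tangent to `{r = const}` has `hessR(u, w) = Hess_g r (w, w) > 0`: the
tangential null geodesic has a strict pericentre, i.e. the cylinder is strongly null
pseudo-convex towards `{r > c}` (the hypersurfaces an Ionescu–Klainerman sweep from infinity
crosses). From `Kerr.deriv_nullRadialPotential_pos_of_photonOrbitRadius_lt` exactly as the inward
half. [cite: IonescuKlainerman2012, Def. 1.1] -/
theorem hessR_pos_of_photonOrbitRadius_lt {M : ℝ} (hM : 0 < M) (ha : |a| < M)
    (hr : photonOrbitRadius M |a| < u 1) (hμ : u 2 ^ 2 < 1)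
    {w : E4} (hw : w ≠ 0) (hnull : bilin M a u w w = 0) (htan : w 1 = 0) :
    0 < hessR M a u w := by
  have hr₁ : rPlus M a < u 1 := by
    have h3 : 3 * M ≤ photonOrbitRadius M |a| := (photonOrbitRadius_mem hM (abs_nonneg a)).1
    have h2 : rPlus M a ≤ 2 * M := by
      have hMa : 0 ≤ M ^ 2 - a ^ 2 := by nlinarith [abs_nonneg a, sq_abs a]
      have : √(M ^ 2 - a ^ 2) ≤ M := by
        rw [Real.sqrt_le_left hM.le]; nlinarith
      unfold rPlus; linarith
    linarith
  have hu : u ∈ regularSet a := mem_regularSet_of_rPlus_lt hM hr₁ hμ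
  have hΔ : 0 < u 1 ^ 2 - 2 * M * u 1 + a ^ 2 := delta_pos_of_rPlus_lt ha.le hr₁
  have hS : 0 < sigma a u ^ 2 := by positivity [hu.1]
  set E := energy M a u w
  set L := angMom M a u w
  set Q := carterQ M a u w
  have hroot : nullRadialPotential M a E L Q (u 1) = 0 := by
    have h := sq_sigma_mul_sq_sub_nullRadialPotential (M := M) hu w
    rw [htan, hnull] at h
    simpa using h
  have hadm : NullThetaAdmissible a E L Q := nullThetaAdmissible_constants hμ w
  have hne : E ≠ 0 ∨ L ≠ 0 ∨ Q ≠ 0 := constants_ne_zero hu hΔ.ne' hw hnull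
  have hd : 0 < deriv (nullRadialPotential M a E L Q) (u 1) :=
    deriv_nullRadialPotential_pos_of_photonOrbitRadius_lt hM ha hr hadm hne hroot
  have hII := two_mul_sq_sigma_mul_hessR_sub_deriv (M := M) hu htan
  rw [hnull, mul_zero] at hII
  have : 0 < 2 * sigma a u ^ 2 * hessR M a u w := by linarith
  have h2S : 0 < 2 * sigma a u ^ 2 := by positivity
  exact pos_of_mul_pos_right this h2S.le

end Ingoing

end Kerr

end Literature.Geometry.Lorentzian

end
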